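import Summits.CriticalPhenomena.PercolationContinuityZ3.Theorems.PercNearOneGluingNoHeavyLowerTailSahiCTCRtThreeWindowThreeDefs
import Summits.CriticalPhenomena.PercolationContinuityZ3.Theorems.PercNearOneGluingNoHeavyLowerTailSahiCTCRtThreeWindowFourSum
import HarnessLib

/-!
# `NoHeavyLowerTail` (crux stmt-CriticalPhenomena-4575), P3 lane: the local window quantity of ROW 1 on `Fin 3` as SIXTEEN WEIGHTED MOMENTS

Support file (seat `prim-l12-p3`, gen 51; `--supports stmt-CriticalPhenomena-4575`).  Memo
`run/shared/lean/prim/prim-l12/FROM-prim-l12-p3-g51-ROW0-ALL-K-LEAN.md` §5.  Row-1 twin of `…RtThreeWindowFourSum` (definitions in `…RtThreeWindowThreeDefs`):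
* `sum_atoms₃_eq`, `cls₃_mem_CL3l`, `sum_atoms₃_by_class`, `atomSum_local₃_eq` : a local atom sum on `Fin 3` with the table of `t`-range `r` is
  `Σ_{c ∈ CL3l} WlocT r k c · momJ₃ c`;
* `pairs_local₃_eq` : the seven localised pair sums of `coeff_rowOne_nonneg_of_local` are `Σ_{m<4} momW m / C(k−m, 3−m)`.
No new definitions; nothing is asserted about the crux.
-/

noncomputable section

open scoped Classical

namespace Summit.CriticalPhenomena.PercolationContinuityZ3.Theorems.SahiCTCForms

open Finset MvPolynomial SahiCTCGenFun

/-! ## Part SUM (row 1): the local quantity on `Fin 3` as sixteen weighted moments -/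

namespace RtThreeFin3

/-- The triple sum over `(A, u, B)` on `Fin 3` is the sum over `atoms₃`. [this work] -/
theorem sum_atoms₃_eq (g : Finset (Fin 3) → Fin 3 → Finset (Fin 3) → ℚ) :
    ∑ x ∈ atoms₃, g x.1 x.2.1 x.2.2 =
      ∑ A ∈ (univ : Finset (Fin 3)).powerset, ∑ u ∈ univ \ A, ∑ B ∈ (univ : Finset (Fin 3)).powerset with u ∉ B, g A u B := by
  unfold atoms₃
  rw [sum_filter, sum_product]
  refine sum_congr rfl fun A _ => ?_
  rw [sum_product, sdiff_eq_filter, sum_filter]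
  refine sum_congr rfl fun u _ => ?_
  by_cases huA : u ∈ A
  · simp [huA]
  · simp only [huA, not_false_eq_true, true_and, if_true, sum_filter]

/-- The class of a triple `(A, u, B)` on `Fin 3` is one of the six classes `CL3l`. [this work] -/
theorem cls₃_mem_CL3l (x : Finset (Fin 3) × Fin 3 × Finset (Fin 3)) : (clsN₃ x, clsS₃ x) ∈ CL3l.toFinset := by
  have key : ∀ n < 4, ∀ s < 4, 1 ≤ n - s → (n, s) ∈ CL3l.toFinset := by decide
  have ha : 1 ≤ #(insert x.2.1 x.1 ∩ insert x.2.1 x.2.2) :=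
    card_pos.2 ⟨x.2.1, mem_inter.2 ⟨mem_insert_self _ _, mem_insert_self _ _⟩⟩
  have hn : #(insert x.2.1 x.1 ∩ insert x.2.1 x.2.2) + #(insert x.2.1 x.1 \ insert x.2.1 x.2.2)
      + #(insert x.2.1 x.2.2 \ insert x.2.1 x.1) ≤ 3 := by
    rw [← card_union_eq_type]; exact (card_le_univ _).trans (by simp)
  unfold clsN₃ clsS₃
  exact key _ (by omega) _ (by omega) (by omega)

/-- Regrouping the `J`-atoms on `Fin 3` by class. [this work] -/
theorem sum_atoms₃_by_class (W : ℕ → ℕ → ℚ) (F G : Finset (Finset (Fin 3))) :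
    ∑ x ∈ atoms₃, W (clsN₃ x) (clsS₃ x) * ((ιq F (insert x.2.1 x.1) - ιq F x.1) * (ιq G (insert x.2.1 x.2.2) - ιq G x.2.2)) =
      ∑ c ∈ CL3l.toFinset, W c.1 c.2 * momJ₃ c.1 c.2 F G := by
  rw [← sum_fiberwise_of_maps_to (s := atoms₃) (t := CL3l.toFinset) (g := fun x => (clsN₃ x, clsS₃ x)) (fun x _ => cls₃_mem_CL3l x)]
  refine sum_congr rfl fun c _ => ?_
  unfold momJ₃ atomsC₃
  rw [mul_sum]
  have hf : atoms₃.filter (fun x => (clsN₃ x, clsS₃ x) = c) = atoms₃.filter (fun x => clsN₃ x = c.1 ∧ clsS₃ x = c.2) :=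
    filter_congr fun x _ => Prod.ext_iff
  rw [hf]
  refine sum_congr rfl fun x hx => ?_
  obtain ⟨_, h1, h2⟩ := mem_filter.1 hx
  rw [h1, h2]

/-- **A local atom sum on `Fin 3` with the table of `t`-range `r` as six weighted moments**: `atomSum = Σ_c WlocT r k c · momJ₃ c`. [this work] -/
theorem atomSum_local₃_eq (r k : ℕ) (F G : Finset (Finset (Fin 3))) :
    atomSum
        (fun a b c => (if 4 ≤ a + b + c then 0 else ∑ t ∈ range r, (((k - a - b - c).choose t : ℕ) : ℚ) *
          (if b + c < k - t then ((((k - t : ℕ) : ℚ)) * ((((k - t - 1).choose (b + c) : ℕ) : ℚ)))⁻¹ else 0))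
          / (((k - (a + b + c)).choose (3 - (a + b + c)) : ℕ) : ℚ))
        (fun a b c => (0 : ℚ) / (((k - (a + b + c)).choose (3 - (a + b + c)) : ℕ) : ℚ)) (fun a b c => (0 : ℚ) / (((k - (a + b + c)).choose (3 - (a + b + c)) : ℕ) : ℚ)) (fun a b c => (0 : ℚ) / (((k - (a + b + c)).choose (3 - (a + b + c)) : ℕ) : ℚ)) (fun a b c => (0 : ℚ) / (((k - (a + b + c)).choose (3 - (a + b + c)) : ℕ) : ℚ)) F G univ =
      ∑ c ∈ CL3l.toFinset, WlocT r k c.1 c.2 * momJ₃ c.1 c.2 F G := by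
  have h0 : (fun a b c => (0 : ℚ) / (((k - (a + b + c)).choose (3 - (a + b + c)) : ℕ) : ℚ)) = fun _ _ _ => (0 : ℚ) := by
    funext a b c; exact zero_div _
  have hJ : (fun a b c => (if 4 ≤ a + b + c then 0 else ∑ t ∈ range r, (((k - a - b - c).choose t : ℕ) : ℚ) *
          (if b + c < k - t then ((((k - t : ℕ) : ℚ)) * ((((k - t - 1).choose (b + c) : ℕ) : ℚ)))⁻¹ else 0))
          / (((k - (a + b + c)).choose (3 - (a + b + c)) : ℕ) : ℚ)) = fun a b c => WlocT r k (a + b + c) (b + c) := by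
    funext a b c; simp only [WlocT, Nat.sub_sub]
  rw [h0, hJ, RtThreeFin4.atomSum_Jonly, ← sum_atoms₃_eq (fun A u B => WlocT r k (#(insert u A ∩ insert u B) + #(insert u A \ insert u B)
      + #(insert u B \ insert u A)) (#(insert u A \ insert u B) + #(insert u B \ insert u A)) *
      ((ιq F (insert u A) - ιq F A) * (ιq G (insert u B) - ιq G B)))]
  exact sum_atoms₃_by_class (WlocT r k) F G

/-- **The seven localised pair sums as four weighted window moments**: `= Σ_{m<4} momW m / C(k−m, 3−m)`. [this work] -/
theorem pairs_local₃_eq (k : ℕ) (X0 X1 Z0 Z1 : Finset (Finset (Fin 3))) :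
    (∑ P ∈ (univ : Finset (Fin 3)).powerset, ∑ P' ∈ (univ : Finset (Fin 3)).powerset,
          ιq (bySize (· < 2) : Finset (Finset (Fin 3))) P * ιq (below 3 ((X1 ∩ Z1) \ (X0 ∪ Z0))) P' * (if Disjoint P P' then 1 else 0) / (((k - #(P ∪ P')).choose (3 - #(P ∪ P')) : ℕ) : ℚ))
      - (∑ P ∈ (univ : Finset (Fin 3)).powerset, ∑ P' ∈ (univ : Finset (Fin 3)).powerset,
          ιq (bySize (· < 3) : Finset (Finset (Fin 3))) P * ιq (below 2 (X1 ∩ Z1)) P' * (if Disjoint P P' then 1 else 0) / (((k - #(P ∪ P')).choose (3 - #(P ∪ P')) : ℕ) : ℚ))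
      - (∑ P ∈ (univ : Finset (Fin 3)).powerset, ∑ P' ∈ (univ : Finset (Fin 3)).powerset,
          ιq (bySize (· < 2) : Finset (Finset (Fin 3))) P * ιq (below 3 (X0 ∩ Z0)) P' * (if Disjoint P P' then 1 else 0) / (((k - #(P ∪ P')).choose (3 - #(P ∪ P')) : ℕ) : ℚ))
      - (∑ P ∈ (univ : Finset (Fin 3)).powerset, ∑ P' ∈ (univ : Finset (Fin 3)).powerset,
          ιq (bySize (· < 2) : Finset (Finset (Fin 3))) P * ιq (below 2 (X1 ∩ Z1)) P' * (if Disjoint P P' then 1 else 0) / (((k - #(P ∪ P')).choose (3 - #(P ∪ P')) : ℕ) : ℚ))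
      + (∑ P ∈ (univ : Finset (Fin 3)).powerset, ∑ P' ∈ (univ : Finset (Fin 3)).powerset,
          ιq (below 2 X1) P * ιq (below 3 Z0) P' * (if Disjoint P P' then 1 else 0) / (((k - #(P ∪ P')).choose (3 - #(P ∪ P')) : ℕ) : ℚ))
      + (∑ P ∈ (univ : Finset (Fin 3)).powerset, ∑ P' ∈ (univ : Finset (Fin 3)).powerset,
          ιq (below 3 X0) P * ιq (below 2 Z1) P' * (if Disjoint P P' then 1 else 0) / (((k - #(P ∪ P')).choose (3 - #(P ∪ P')) : ℕ) : ℚ))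
      + (∑ P ∈ (univ : Finset (Fin 3)).powerset, ∑ P' ∈ (univ : Finset (Fin 3)).powerset,
          ιq (below 2 X1) P * ιq (below 2 Z1) P' * (if Disjoint P P' then 1 else 0) / (((k - #(P ∪ P')).choose (3 - #(P ∪ P')) : ℕ) : ℚ)) =
      ∑ m ∈ range 4, (1 / (((k - m).choose (3 - m) : ℕ) : ℚ)) * momW m X0 X1 Z0 Z1 := by
  -- combine the seven double sums into one
  simp only [← sum_sub_distrib, ← sum_add_distrib]
  rw [← sum_product (s := (univ : Finset (Fin 3)).powerset) (t := (univ : Finset (Fin 3)).powerset)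
    (f := fun x => ιq (bySize (· < 2) : Finset (Finset (Fin 3))) x.1 * ιq (below 3 ((X1 ∩ Z1) \ (X0 ∪ Z0))) x.2 * (if Disjoint x.1 x.2 then 1 else 0) / (((k - #(x.1 ∪ x.2)).choose (3 - #(x.1 ∪ x.2)) : ℕ) : ℚ)
      - ιq (bySize (· < 3) : Finset (Finset (Fin 3))) x.1 * ιq (below 2 (X1 ∩ Z1)) x.2 * (if Disjoint x.1 x.2 then 1 else 0) / (((k - #(x.1 ∪ x.2)).choose (3 - #(x.1 ∪ x.2)) : ℕ) : ℚ)
      - ιq (bySize (· < 2) : Finset (Finset (Fin 3))) x.1 * ιq (below 3 (X0 ∩ Z0)) x.2 * (if Disjoint x.1 x.2 then 1 else 0) / (((k - #(x.1 ∪ x.2)).choose (3 - #(x.1 ∪ x.2)) : ℕ) : ℚ)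
      - ιq (bySize (· < 2) : Finset (Finset (Fin 3))) x.1 * ιq (below 2 (X1 ∩ Z1)) x.2 * (if Disjoint x.1 x.2 then 1 else 0) / (((k - #(x.1 ∪ x.2)).choose (3 - #(x.1 ∪ x.2)) : ℕ) : ℚ)
      + ιq (below 2 X1) x.1 * ιq (below 3 Z0) x.2 * (if Disjoint x.1 x.2 then 1 else 0) / (((k - #(x.1 ∪ x.2)).choose (3 - #(x.1 ∪ x.2)) : ℕ) : ℚ)
      + ιq (below 3 X0) x.1 * ιq (below 2 Z1) x.2 * (if Disjoint x.1 x.2 then 1 else 0) / (((k - #(x.1 ∪ x.2)).choose (3 - #(x.1 ∪ x.2)) : ℕ) : ℚ)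
      + ιq (below 2 X1) x.1 * ιq (below 2 Z1) x.2 * (if Disjoint x.1 x.2 then 1 else 0) / (((k - #(x.1 ∪ x.2)).choose (3 - #(x.1 ∪ x.2)) : ℕ) : ℚ))]
  have hmaps : ∀ x ∈ (univ : Finset (Fin 3)).powerset ×ˢ (univ : Finset (Fin 3)).powerset, #(x.1 ∪ x.2) ∈ range 4 := fun x _ =>
    mem_range.2 (Nat.lt_succ_of_le ((card_le_univ _).trans (by simp)))
  rw [← sum_fiberwise_of_maps_to hmaps]
  refine sum_congr rfl fun m _ => ?_
  unfold momW pairsC₃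
  rw [mul_sum]
  have hf : ((univ : Finset (Fin 3)).powerset ×ˢ (univ : Finset (Fin 3)).powerset).filter (fun x => Disjoint x.1 x.2 ∧ #(x.1 ∪ x.2) = m) =
      (((univ : Finset (Fin 3)).powerset ×ˢ (univ : Finset (Fin 3)).powerset).filter (fun x => #(x.1 ∪ x.2) = m)).filter
        (fun x => Disjoint x.1 x.2) := by
    rw [filter_filter]; exact filter_congr fun x _ => and_comm
  rw [hf]
  conv_rhs => rw [sum_filter]
  refine sum_congr rfl fun x hx => ?_
  rw [(mem_filter.1 hx).2]
  by_cases hd : Disjoint x.1 x.2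
  · rw [if_pos hd, if_pos hd]; ring
  · rw [if_neg hd, if_neg hd]; ring

end RtThreeFin3

end Summit.CriticalPhenomena.PercolationContinuityZ3.Theorems.SahiCTCForms
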